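import Literature.Analysis.Matrix.TraceInvMulMixedDifference
import HarnessLib

/-!
# The mixed second difference of `K⁻¹H` over a rectangle — THE ENTRYWISE-ℓ¹ (HENCE HILBERT–SCHMIDT) EDITION of `TraceInvMulMixedDifference`

Topic `Literature/Analysis/Matrix`; namespace `Literature.Analysis.Matrix`.  Sequel of `TraceInvMulMixedDifference.lean` (the TRACE rectangle
`abs_fourPt_trace_inv_mul_le_of_summedProfiles`, the algebra `doubleDiff_mul_eq_matrix` ∕ `inv_sub_inv_eq_neg_mul` ∕ `doubleDiff_inv_eq`, and the ℓ¹
sandwich bound `sum_sum_abs_mul3_le_of_summedProfiles`).  Everything here is PROVED; no definitions, no named facts.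

THE POINT.  The one-loop item of the consumer asks not only for the TRACE of the second variation `ΔΔ(K⁻¹H)` of the (whitened) one-loop operator but
also for its HILBERT–SCHMIDT norm, with the same `e^{−κ·tdist(b,b′)}` decay (cell `ym3-torus`, LEAD RULING №58: «tr AND HS, uniform in `L^m`»).  Under
EXACTLY the rows of the trace rectangle (Combes–Thomas profile `α, θ` of the four inverses; summed one-profile rows `k₁ k₂ h₁ h₂`; ℓ¹ two-profile rows
`k₁₂ h₁₂`; `Σ|H₀₀| ≤ η`; symmetric `dist`; local sums `S_loc, S_dist`) the whole ENTRYWISE ℓ¹ norm of `ΔΔ(K⁻¹H)` obeys the trace bound times ONE more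
local sum `S_dist` (the column∕row-sum norm of a Combes–Thomas kernel is `≤ α·S_dist`), and the Hilbert–Schmidt norm is at most the entrywise ℓ¹ norm:
* §1 `colSum_le_of_ctProfile`, `rowSum_le_of_ctProfile` (`Σ_a |A a c|, Σ_e |A a e| ≤ α·S_dist`), `sum_sum_abs_mul_le_of_colSum` (`ℓ¹(A·X) ≤ c_A·ℓ¹(X)`),
  `sum_sum_abs_mul_le_of_rowSum` (`ℓ¹(X·Y) ≤ ℓ¹(X)·r_Y`), `rowSum_mul_le_of_entry_of_sum` (`Σ_e |(A·H) a e| ≤ α·η`), `sum_sum_sq_le_sq_sum_sum_abs`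
  (`Σ x² ≤ (Σ|x|)²`).
* §2 ★★`sum_sum_abs_fourPt_inv_mul_le_of_summedProfiles` —
  `Σ_{a,e} |ΔΔ(K⁻¹H) a e| ≤ α·S_dist·(h₁₂ + α·S_loc·S_dist·(k₁h₂ + k₂h₁) + α·η·k₁₂ + 2·α²·η·S_loc·S_dist·k₁k₂)·s·t·e^{−(θ−θ₂)R}`;
  ★`sqrt_sum_sum_sq_fourPt_inv_mul_le_of_summedProfiles` — the same bound for `√(Σ_{a,e} (ΔΔ(K⁻¹H) a e)²)` (Hilbert–Schmidt).
* §3 `abs_dotProduct_mulVec_le_of_sup` (`|zᵀXz| ≤ ‖z‖_∞²·Σ|X|`), ★`abs_quadForm_fourPt_inv_mul_le_of_summedProfiles` — the POINTWISE quadratic form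
  `|zᵀ·ΔΔ(K⁻¹H)·z| ≤ ρ²·(the ℓ¹ bound)` for every `z` in the sup-ball of radius `ρ` (appended §3).

HONEST SCOPE: finite-dimensional linear algebra; the rows are hypotheses; the m-uniformity of the constants in the consumer's indexing
([Balaban1984PropagatorsII] (1.33); for the whitened `K^{−1∕2}`-sandwich, [Balaban1988RG2Cluster] (2.7)) is NOT addressed.  Nothing here bears on the
Yang–Mills mass gap (Clay), which is NOT proved.

References: T. Bałaban, CMP 102 (1985) 277, Thm 1 (10) p. 279 [Balaban1985Variational]; CMP 96 (1984) 223, (1.33) [Balaban1984PropagatorsII];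
J. Glimm, A. Jaffe, *Quantum Physics* (1987) §18.2 [GlimmJaffe1987]; R. A. Horn, C. R. Johnson, *Matrix Analysis* (2013) §5.6 [HornJohnson2013].
-/

noncomputable section

open Matrix Finset
open scoped Matrix

namespace Literature.Analysis.Matrix

variable {n : Type*} [Fintype n] [DecidableEq n]

/-! ## §1 ℓ¹ bookkeeping for products with a kernel factor -/

omit [DecidableEq n] in
/-- Column sums of a Combes–Thomas kernel: `|A a c| ≤ α·e^{−θ·dist a c}`, `dist` symmetric, `θ₂ ≤ θ`, `Σ_b e^{−θ₂·dist a b} ≤ S_dist`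
⟹ `Σ_a |A a c| ≤ α·S_dist`. [cite: AizenmanWarzel2015, §10.3] -/
theorem colSum_le_of_ctProfile (dist : n → n → ℕ) (hds : ∀ a b, dist a b = dist b a) {A : Matrix n n ℝ} {α θ θ₂ Sdist : ℝ}
    (hα : 0 ≤ α) (hθ₂θ : θ₂ ≤ θ) (hA : ∀ a b, |A a b| ≤ α * Real.exp (-(θ * dist a b)))
    (hSdi : ∀ a, ∑ b, Real.exp (-(θ₂ * dist a b)) ≤ Sdist) (c : n) :
    ∑ a, |A a c| ≤ α * Sdist := by
  calc ∑ a, |A a c| ≤ ∑ a, α * Real.exp (-(θ₂ * dist c a)) := Finset.sum_le_sum fun a _ => by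
        refine (hA a c).trans (mul_le_mul_of_nonneg_left (Real.exp_le_exp.2 ?_) hα)
        rw [hds a c]
        have : (0 : ℝ) ≤ dist c a := Nat.cast_nonneg _
        nlinarith
    _ = α * ∑ a, Real.exp (-(θ₂ * dist c a)) := by rw [Finset.mul_sum]
    _ ≤ α * Sdist := mul_le_mul_of_nonneg_left (hSdi c) hα

omit [DecidableEq n] in
/-- Row sums of a Combes–Thomas kernel: `Σ_e |A a e| ≤ α·S_dist`. [cite: AizenmanWarzel2015, §10.3] -/
theorem rowSum_le_of_ctProfile (dist : n → n → ℕ) {A : Matrix n n ℝ} {α θ θ₂ Sdist : ℝ}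
    (hα : 0 ≤ α) (hθ₂θ : θ₂ ≤ θ) (hA : ∀ a b, |A a b| ≤ α * Real.exp (-(θ * dist a b)))
    (hSdi : ∀ a, ∑ b, Real.exp (-(θ₂ * dist a b)) ≤ Sdist) (a : n) :
    ∑ e, |A a e| ≤ α * Sdist := by
  calc ∑ e, |A a e| ≤ ∑ e, α * Real.exp (-(θ₂ * dist a e)) := Finset.sum_le_sum fun e _ => by
        refine (hA a e).trans (mul_le_mul_of_nonneg_left (Real.exp_le_exp.2 ?_) hα)
        have : (0 : ℝ) ≤ dist a e := Nat.cast_nonneg _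
        nlinarith
    _ = α * ∑ e, Real.exp (-(θ₂ * dist a e)) := by rw [Finset.mul_sum]
    _ ≤ α * Sdist := mul_le_mul_of_nonneg_left (hSdi a) hα

omit [DecidableEq n] in
/-- `ℓ¹(A·X) ≤ c_A·ℓ¹(X)` when the COLUMN sums of `A` are `≤ c_A`. [cite: HornJohnson2013, §5.6] -/
theorem sum_sum_abs_mul_le_of_colSum {A X : Matrix n n ℝ} {cA : ℝ} (hA : ∀ c, ∑ a, |A a c| ≤ cA) :
    ∑ a, ∑ e, |(A * X) a e| ≤ cA * ∑ c, ∑ e, |X c e| := by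
  have hpt : ∀ a e, |(A * X) a e| ≤ ∑ c, |A a c| * |X c e| := fun a e => by
    rw [Matrix.mul_apply]
    exact (Finset.abs_sum_le_sum_abs _ _).trans (le_of_eq (Finset.sum_congr rfl fun c _ => abs_mul _ _))
  calc ∑ a, ∑ e, |(A * X) a e| ≤ ∑ a, ∑ e, ∑ c, |A a c| * |X c e| :=
        Finset.sum_le_sum fun a _ => Finset.sum_le_sum fun e _ => hpt a e
    _ = ∑ e, ∑ c, (∑ a, |A a c|) * |X c e| := by
        rw [Finset.sum_comm]
        refine Finset.sum_congr rfl fun e _ => ?_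
        rw [Finset.sum_comm]
        exact Finset.sum_congr rfl fun c _ => by rw [Finset.sum_mul]
    _ ≤ ∑ e, ∑ c, cA * |X c e| := Finset.sum_le_sum fun e _ => Finset.sum_le_sum fun c _ =>
        mul_le_mul_of_nonneg_right (hA c) (abs_nonneg _)
    _ = cA * ∑ c, ∑ e, |X c e| := by
        rw [Finset.sum_comm, Finset.mul_sum]
        exact Finset.sum_congr rfl fun c _ => by rw [Finset.mul_sum]

omit [DecidableEq n] in
/-- `ℓ¹(X·Y) ≤ ℓ¹(X)·r_Y` when the ROW sums of `Y` are `≤ r_Y`. [cite: HornJohnson2013, §5.6] -/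
theorem sum_sum_abs_mul_le_of_rowSum {X Y : Matrix n n ℝ} {rY : ℝ} (hY : ∀ c, ∑ e, |Y c e| ≤ rY) :
    ∑ a, ∑ e, |(X * Y) a e| ≤ (∑ a, ∑ c, |X a c|) * rY := by
  have hpt : ∀ a e, |(X * Y) a e| ≤ ∑ c, |X a c| * |Y c e| := fun a e => by
    rw [Matrix.mul_apply]
    exact (Finset.abs_sum_le_sum_abs _ _).trans (le_of_eq (Finset.sum_congr rfl fun c _ => abs_mul _ _))
  calc ∑ a, ∑ e, |(X * Y) a e| ≤ ∑ a, ∑ e, ∑ c, |X a c| * |Y c e| :=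
        Finset.sum_le_sum fun a _ => Finset.sum_le_sum fun e _ => hpt a e
    _ = ∑ a, ∑ c, |X a c| * ∑ e, |Y c e| := by
        refine Finset.sum_congr rfl fun a _ => ?_
        rw [Finset.sum_comm]
        exact Finset.sum_congr rfl fun c _ => by rw [Finset.mul_sum]
    _ ≤ ∑ a, ∑ c, |X a c| * rY := Finset.sum_le_sum fun a _ => Finset.sum_le_sum fun c _ =>
        mul_le_mul_of_nonneg_left (hY c) (abs_nonneg _)
    _ = (∑ a, ∑ c, |X a c|) * rY := by
        rw [Finset.sum_mul]; exact Finset.sum_congr rfl fun a _ => by rw [Finset.sum_mul]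

omit [DecidableEq n] in
/-- Row sums of `A·H` with `|A| ≤ α` and `Σ|H| ≤ η`: `Σ_e |(A·H) a e| ≤ α·η`. [cite: HornJohnson2013, §5.6] -/
theorem rowSum_mul_le_of_entry_of_sum {A H : Matrix n n ℝ} {α η : ℝ} (hα : 0 ≤ α) (hA : ∀ a b, |A a b| ≤ α)
    (hH : ∑ c, ∑ e, |H c e| ≤ η) (a : n) : ∑ e, |(A * H) a e| ≤ α * η := by
  have hpt : ∀ e, |(A * H) a e| ≤ ∑ c, α * |H c e| := fun e => by
    rw [Matrix.mul_apply]
    refine (Finset.abs_sum_le_sum_abs _ _).trans (Finset.sum_le_sum fun c _ => ?_)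
    rw [abs_mul]; exact mul_le_mul_of_nonneg_right (hA a c) (abs_nonneg _)
  calc ∑ e, |(A * H) a e| ≤ ∑ e, ∑ c, α * |H c e| := Finset.sum_le_sum fun e _ => hpt e
    _ = α * ∑ c, ∑ e, |H c e| := by
        rw [Finset.sum_comm, Finset.mul_sum]
        exact Finset.sum_congr rfl fun c _ => by rw [Finset.mul_sum]
    _ ≤ α * η := mul_le_mul_of_nonneg_left hH hα

omit [DecidableEq n] in
/-- `Σ_{a,e} (X a e)² ≤ (Σ_{a,e} |X a e|)²` — the Hilbert–Schmidt norm is at most the entrywise ℓ¹ norm. [cite: HornJohnson2013, §5.6] -/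
theorem sum_sum_sq_le_sq_sum_sum_abs (X : Matrix n n ℝ) :
    ∑ a, ∑ e, (X a e) ^ 2 ≤ (∑ a, ∑ e, |X a e|) ^ 2 := by
  have hT : 0 ≤ ∑ a, ∑ e, |X a e| := Finset.sum_nonneg fun a _ => Finset.sum_nonneg fun e _ => abs_nonneg _
  have hle : ∀ a e, |X a e| ≤ ∑ a, ∑ e, |X a e| := fun a e =>
    le_trans (Finset.single_le_sum (f := fun e => |X a e|) (fun e _ => abs_nonneg _) (Finset.mem_univ e))
      (Finset.single_le_sum (f := fun a => ∑ e, |X a e|) (fun a _ => Finset.sum_nonneg fun e _ => abs_nonneg _)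
        (Finset.mem_univ a))
  calc ∑ a, ∑ e, (X a e) ^ 2 = ∑ a, ∑ e, |X a e| * |X a e| := by
        refine Finset.sum_congr rfl fun a _ => Finset.sum_congr rfl fun e _ => ?_
        rw [abs_mul_abs_self, sq]
    _ ≤ ∑ a, ∑ e, |X a e| * ∑ a, ∑ e, |X a e| := Finset.sum_le_sum fun a _ => Finset.sum_le_sum fun e _ =>
        mul_le_mul_of_nonneg_left (hle a e) (abs_nonneg _)
    _ = (∑ a, ∑ e, |X a e|) ^ 2 := by
        rw [pow_two, Finset.sum_mul]
        exact Finset.sum_congr rfl fun a _ => by rw [Finset.sum_mul]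

/-! ## §2 The entrywise-ℓ¹ and Hilbert–Schmidt rectangle -/

/-- ★★ **`Σ|ΔΔ(K⁻¹H)|` OVER A RECTANGLE WITH LOCALLY SUMMED VARIATIONS (entrywise ℓ¹; no `Fintype.card`).**  Under the rows of
`abs_fourPt_trace_inv_mul_le_of_summedProfiles` VERBATIM (Combes–Thomas profile `α, θ` of the four inverses; symmetric `dist`; separation
`R ≤ d a + dist a b + d′ b`; local sums `S_loc, S_dist`; the five summed one-profile rows of `Δ¹K₀, Δ¹K₁, Δ²K₁` (columns) and `Δ¹K₀, Δ²K₀` (rows);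
ℓ¹ rows for `ΔΔK`, `H₀₀`, `ΔΔH`; row-summed `Δ¹H₀, Δ²H₀`):
`Σ_{a,e} |(K₁₁⁻¹H₁₁ − K₁₀⁻¹H₁₀ − K₀₁⁻¹H₀₁ + K₀₀⁻¹H₀₀) a e| ≤ α·S_dist·(h₁₂ + α·S_loc·S_dist·(k₁h₂ + k₂h₁) + α·η·k₁₂ + 2·α²·η·S_loc·S_dist·k₁k₂)·s·t·e^{−(θ−θ₂)R}`
— the trace rectangle's polynomial times the column-sum norm `α·S_dist` of the outer kernel. [cite: Balaban1985Variational, Thm 1 (10) p. 279]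
[cite: GlimmJaffe1987, §18.2] -/
theorem sum_sum_abs_fourPt_inv_mul_le_of_summedProfiles (dist : n → n → ℕ) (hds : ∀ a b, dist a b = dist b a)
    {K₀₀ K₀₁ K₁₀ K₁₁ H₀₀ H₀₁ H₁₀ H₁₁ : Matrix n n ℝ}
    (h₀₀ : K₀₀.det ≠ 0) (h₀₁ : K₀₁.det ≠ 0) (h₁₀ : K₁₀.det ≠ 0) (h₁₁ : K₁₁.det ≠ 0)
    {α η k₁ k₂ k₁₂ h₁ h₂ h₁₂ s t θ θ₂ Sloc Sdist : ℝ}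
    (hα : 0 ≤ α) (hk₁ : 0 ≤ k₁) (hk₂ : 0 ≤ k₂) (hh₁ : 0 ≤ h₁) (hh₂ : 0 ≤ h₂) (hs : 0 ≤ s) (ht : 0 ≤ t)
    (hθ₂ : 0 ≤ θ₂) (hθ₂θ : θ₂ ≤ θ) (hSdist0 : 0 ≤ Sdist)
    (hA₀₀ : ∀ a b, |K₀₀⁻¹ a b| ≤ α * Real.exp (-(θ * dist a b)))
    (hA₀₁ : ∀ a b, |K₀₁⁻¹ a b| ≤ α * Real.exp (-(θ * dist a b)))
    (hA₁₀ : ∀ a b, |K₁₀⁻¹ a b| ≤ α * Real.exp (-(θ * dist a b)))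
    (hA₁₁ : ∀ a b, |K₁₁⁻¹ a b| ≤ α * Real.exp (-(θ * dist a b)))
    {d d' : n → ℕ} {R : ℕ} (hsep : ∀ a b, R ≤ d a + dist a b + d' b)
    (hSd : ∑ a, Real.exp (-(θ₂ * d a)) ≤ Sloc) (hSd' : ∑ a, Real.exp (-(θ₂ * d' a)) ≤ Sloc)
    (hSdi : ∀ a, ∑ b, Real.exp (-(θ₂ * dist a b)) ≤ Sdist)
    (hK1c0 : ∀ b, ∑ a, |(K₁₀ - K₀₀) a b| ≤ k₁ * s * Real.exp (-(θ * d b)))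
    (hK1c1 : ∀ b, ∑ a, |(K₁₁ - K₀₁) a b| ≤ k₁ * s * Real.exp (-(θ * d b)))
    (hK1r0 : ∀ a, ∑ b, |(K₁₀ - K₀₀) a b| ≤ k₁ * s * Real.exp (-(θ * d a)))
    (hK2c1 : ∀ b, ∑ a, |(K₁₁ - K₁₀) a b| ≤ k₂ * t * Real.exp (-(θ * d' b)))
    (hK2r0 : ∀ a, ∑ b, |(K₀₁ - K₀₀) a b| ≤ k₂ * t * Real.exp (-(θ * d' a)))
    (hK12 : ∑ a, ∑ b, |(K₁₁ - K₁₀ - K₀₁ + K₀₀) a b| ≤ k₁₂ * s * t * Real.exp (-((θ - θ₂) * R)))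
    (hH : ∑ a, ∑ b, |H₀₀ a b| ≤ η)
    (hH1r : ∀ a, ∑ b, |(H₁₀ - H₀₀) a b| ≤ h₁ * s * Real.exp (-(θ * d a)))
    (hH2r : ∀ a, ∑ b, |(H₀₁ - H₀₀) a b| ≤ h₂ * t * Real.exp (-(θ * d' a)))
    (hH12 : ∑ a, ∑ b, |(H₁₁ - H₁₀ - H₀₁ + H₀₀) a b| ≤ h₁₂ * s * t * Real.exp (-((θ - θ₂) * R))) :
    ∑ a, ∑ e, |(K₁₁⁻¹ * H₁₁ - K₁₀⁻¹ * H₁₀ - K₀₁⁻¹ * H₀₁ + K₀₀⁻¹ * H₀₀) a e| ≤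
      α * Sdist * (h₁₂ + α * Sloc * Sdist * (k₁ * h₂ + k₂ * h₁) + α * η * k₁₂ +
          2 * α ^ 2 * η * Sloc * Sdist * k₁ * k₂) * s * t * Real.exp (-((θ - θ₂) * R)) := by
  set Ex : ℝ := Real.exp (-((θ - θ₂) * R)) with hEx
  have hθ : 0 ≤ θ := hθ₂.trans hθ₂θ
  have hent : ∀ {A : Matrix n n ℝ}, (∀ a b, |A a b| ≤ α * Real.exp (-(θ * dist a b))) → ∀ a b, |A a b| ≤ α := by
    intro A hA a b
    refine (hA a b).trans ?_
    have : Real.exp (-(θ * dist a b)) ≤ 1 := by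
      rw [Real.exp_le_one_iff]
      have : (0 : ℝ) ≤ dist a b := Nat.cast_nonneg _
      nlinarith
    simpa using mul_le_mul_of_nonneg_left this hα
  have hη : 0 ≤ η := (Finset.sum_nonneg fun a _ => Finset.sum_nonneg fun b _ => abs_nonneg _).trans hH
  have hsep' : ∀ a b, R ≤ d' a + dist a b + d b := by
    intro a b; have := hsep b a; rw [hds] at this; omega
  -- column sums of the outer kernel `K₁₁⁻¹`, row sums of `K⁻¹·H₀₀`
  have hc₁₁ : ∀ c, ∑ a, |K₁₁⁻¹ a c| ≤ α * Sdist := colSum_le_of_ctProfile dist hds hα hθ₂θ hA₁₁ hSdi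
  have hrAH : ∀ {A : Matrix n n ℝ}, (∀ a b, |A a b| ≤ α * Real.exp (-(θ * dist a b))) →
      ∀ a, ∑ e, |(A * H₀₀) a e| ≤ α * η := fun hA => rowSum_mul_le_of_entry_of_sum hα (hent hA) hH
  have hαS : 0 ≤ α * Sdist := mul_nonneg hα hSdist0
  -- STEP 1: the algebraic expansion (as in the trace rectangle)
  have e1 : K₁₁⁻¹ - K₀₁⁻¹ = -(K₁₁⁻¹ * (K₁₁ - K₀₁) * K₀₁⁻¹) := inv_sub_inv_eq_neg_mul h₀₁ h₁₁
  have e4 : K₁₁⁻¹ - K₁₀⁻¹ = -(K₁₁⁻¹ * (K₁₁ - K₁₀) * K₁₀⁻¹) := inv_sub_inv_eq_neg_mul h₁₀ h₁₁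
  have expand : K₁₁⁻¹ * H₁₁ - K₁₀⁻¹ * H₁₀ - K₀₁⁻¹ * H₀₁ + K₀₀⁻¹ * H₀₀ =
      K₁₁⁻¹ * (H₁₁ - H₁₀ - H₀₁ + H₀₀)
        - K₁₁⁻¹ * ((K₁₁ - K₀₁) * K₀₁⁻¹ * (H₀₁ - H₀₀))
        - K₁₁⁻¹ * ((K₁₁ - K₁₀) * K₁₀⁻¹ * (H₁₀ - H₀₀))
        - K₁₁⁻¹ * ((K₁₁ - K₁₀ - K₀₁ + K₀₀) * (K₀₁⁻¹ * H₀₀))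
        + K₁₁⁻¹ * ((K₁₀ - K₀₀) * K₀₁⁻¹ * (K₀₁ - K₀₀) * (K₀₀⁻¹ * H₀₀))
        + K₁₁⁻¹ * ((K₁₁ - K₁₀) * K₁₀⁻¹ * (K₁₀ - K₀₀) * (K₀₀⁻¹ * H₀₀)) := by
    rw [doubleDiff_mul_eq_matrix, doubleDiff_inv_eq h₀₀ h₀₁ h₁₀ h₁₁, e1, e4]
    noncomm_ring
  -- STEP 2: ℓ¹ bounds of the six terms
  have T1 : ∑ a, ∑ e, |(K₁₁⁻¹ * (H₁₁ - H₁₀ - H₀₁ + H₀₀)) a e| ≤ α * Sdist * (h₁₂ * s * t * Ex) :=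
    (sum_sum_abs_mul_le_of_colSum hc₁₁).trans (mul_le_mul_of_nonneg_left hH12 hαS)
  have L2 : ∑ a, ∑ e, |((K₁₁ - K₀₁) * K₀₁⁻¹ * (H₀₁ - H₀₀)) a e| ≤ (k₁ * s) * α * (h₂ * t) * Sloc * Sdist * Ex :=
    sum_sum_abs_mul3_le_of_summedProfiles dist (by positivity) hα (by positivity) hθ₂ hθ₂θ hSdist0
      hK1c1 hA₀₁ hH2r hsep hSd hSdi
  have T2 : ∑ a, ∑ e, |(K₁₁⁻¹ * ((K₁₁ - K₀₁) * K₀₁⁻¹ * (H₀₁ - H₀₀))) a e| ≤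
      α * Sdist * ((k₁ * s) * α * (h₂ * t) * Sloc * Sdist * Ex) :=
    (sum_sum_abs_mul_le_of_colSum hc₁₁).trans (mul_le_mul_of_nonneg_left L2 hαS)
  have L3 : ∑ a, ∑ e, |((K₁₁ - K₁₀) * K₁₀⁻¹ * (H₁₀ - H₀₀)) a e| ≤ (k₂ * t) * α * (h₁ * s) * Sloc * Sdist * Ex :=
    sum_sum_abs_mul3_le_of_summedProfiles dist (by positivity) hα (by positivity) hθ₂ hθ₂θ hSdist0
      hK2c1 hA₁₀ hH1r hsep' hSd' hSdi
  have T3 : ∑ a, ∑ e, |(K₁₁⁻¹ * ((K₁₁ - K₁₀) * K₁₀⁻¹ * (H₁₀ - H₀₀))) a e| ≤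
      α * Sdist * ((k₂ * t) * α * (h₁ * s) * Sloc * Sdist * Ex) :=
    (sum_sum_abs_mul_le_of_colSum hc₁₁).trans (mul_le_mul_of_nonneg_left L3 hαS)
  have L4a : ∑ a, ∑ e, |((K₁₁ - K₁₀ - K₀₁ + K₀₀) * (K₀₁⁻¹ * H₀₀)) a e| ≤ (k₁₂ * s * t * Ex) * (α * η) :=
    (sum_sum_abs_mul_le_of_rowSum (hrAH hA₀₁)).trans (mul_le_mul_of_nonneg_right hK12 (by positivity))
  have T4a : ∑ a, ∑ e, |(K₁₁⁻¹ * ((K₁₁ - K₁₀ - K₀₁ + K₀₀) * (K₀₁⁻¹ * H₀₀))) a e| ≤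
      α * Sdist * ((k₁₂ * s * t * Ex) * (α * η)) :=
    (sum_sum_abs_mul_le_of_colSum hc₁₁).trans (mul_le_mul_of_nonneg_left L4a hαS)
  have L4b₀ : ∑ a, ∑ e, |((K₁₀ - K₀₀) * K₀₁⁻¹ * (K₀₁ - K₀₀)) a e| ≤ (k₁ * s) * α * (k₂ * t) * Sloc * Sdist * Ex :=
    sum_sum_abs_mul3_le_of_summedProfiles dist (by positivity) hα (by positivity) hθ₂ hθ₂θ hSdist0
      hK1c0 hA₀₁ hK2r0 hsep hSd hSdi
  have L4b : ∑ a, ∑ e, |((K₁₀ - K₀₀) * K₀₁⁻¹ * (K₀₁ - K₀₀) * (K₀₀⁻¹ * H₀₀)) a e| ≤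
      ((k₁ * s) * α * (k₂ * t) * Sloc * Sdist * Ex) * (α * η) :=
    (sum_sum_abs_mul_le_of_rowSum (hrAH hA₀₀)).trans (mul_le_mul_of_nonneg_right L4b₀ (by positivity))
  have T4b : ∑ a, ∑ e, |(K₁₁⁻¹ * ((K₁₀ - K₀₀) * K₀₁⁻¹ * (K₀₁ - K₀₀) * (K₀₀⁻¹ * H₀₀))) a e| ≤
      α * Sdist * (((k₁ * s) * α * (k₂ * t) * Sloc * Sdist * Ex) * (α * η)) :=
    (sum_sum_abs_mul_le_of_colSum hc₁₁).trans (mul_le_mul_of_nonneg_left L4b hαS)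
  have L4c₀ : ∑ a, ∑ e, |((K₁₁ - K₁₀) * K₁₀⁻¹ * (K₁₀ - K₀₀)) a e| ≤ (k₂ * t) * α * (k₁ * s) * Sloc * Sdist * Ex :=
    sum_sum_abs_mul3_le_of_summedProfiles dist (by positivity) hα (by positivity) hθ₂ hθ₂θ hSdist0
      hK2c1 hA₁₀ hK1r0 hsep' hSd' hSdi
  have L4c : ∑ a, ∑ e, |((K₁₁ - K₁₀) * K₁₀⁻¹ * (K₁₀ - K₀₀) * (K₀₀⁻¹ * H₀₀)) a e| ≤
      ((k₂ * t) * α * (k₁ * s) * Sloc * Sdist * Ex) * (α * η) :=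
    (sum_sum_abs_mul_le_of_rowSum (hrAH hA₀₀)).trans (mul_le_mul_of_nonneg_right L4c₀ (by positivity))
  have T4c : ∑ a, ∑ e, |(K₁₁⁻¹ * ((K₁₁ - K₁₀) * K₁₀⁻¹ * (K₁₀ - K₀₀) * (K₀₀⁻¹ * H₀₀))) a e| ≤
      α * Sdist * (((k₂ * t) * α * (k₁ * s) * Sloc * Sdist * Ex) * (α * η)) :=
    (sum_sum_abs_mul_le_of_colSum hc₁₁).trans (mul_le_mul_of_nonneg_left L4c hαS)
  -- STEP 3: entrywise triangle inequality and assembly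
  rw [expand]
  have tri : ∀ a e,
      |((K₁₁⁻¹ * (H₁₁ - H₁₀ - H₀₁ + H₀₀)
        - K₁₁⁻¹ * ((K₁₁ - K₀₁) * K₀₁⁻¹ * (H₀₁ - H₀₀))
        - K₁₁⁻¹ * ((K₁₁ - K₁₀) * K₁₀⁻¹ * (H₁₀ - H₀₀))
        - K₁₁⁻¹ * ((K₁₁ - K₁₀ - K₀₁ + K₀₀) * (K₀₁⁻¹ * H₀₀))
        + K₁₁⁻¹ * ((K₁₀ - K₀₀) * K₀₁⁻¹ * (K₀₁ - K₀₀) * (K₀₀⁻¹ * H₀₀))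
        + K₁₁⁻¹ * ((K₁₁ - K₁₀) * K₁₀⁻¹ * (K₁₀ - K₀₀) * (K₀₀⁻¹ * H₀₀))) a e)| ≤
      |(K₁₁⁻¹ * (H₁₁ - H₁₀ - H₀₁ + H₀₀)) a e|
        + |(K₁₁⁻¹ * ((K₁₁ - K₀₁) * K₀₁⁻¹ * (H₀₁ - H₀₀))) a e|
        + |(K₁₁⁻¹ * ((K₁₁ - K₁₀) * K₁₀⁻¹ * (H₁₀ - H₀₀))) a e|
        + |(K₁₁⁻¹ * ((K₁₁ - K₁₀ - K₀₁ + K₀₀) * (K₀₁⁻¹ * H₀₀))) a e|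
        + |(K₁₁⁻¹ * ((K₁₀ - K₀₀) * K₀₁⁻¹ * (K₀₁ - K₀₀) * (K₀₀⁻¹ * H₀₀))) a e|
        + |(K₁₁⁻¹ * ((K₁₁ - K₁₀) * K₁₀⁻¹ * (K₁₀ - K₀₀) * (K₀₀⁻¹ * H₀₀))) a e| := by
    intro a e
    simp only [Matrix.add_apply, Matrix.sub_apply]
    have n1 := fun (x y : ℝ) => abs_add_le x y
    have n2 := fun (x y : ℝ) => abs_sub x y
    linarith [n2 ((K₁₁⁻¹ * (H₁₁ - H₁₀ - H₀₁ + H₀₀)) a e) ((K₁₁⁻¹ * ((K₁₁ - K₀₁) * K₀₁⁻¹ * (H₀₁ - H₀₀))) a e),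
      n2 ((K₁₁⁻¹ * (H₁₁ - H₁₀ - H₀₁ + H₀₀)) a e - (K₁₁⁻¹ * ((K₁₁ - K₀₁) * K₀₁⁻¹ * (H₀₁ - H₀₀))) a e)
        ((K₁₁⁻¹ * ((K₁₁ - K₁₀) * K₁₀⁻¹ * (H₁₀ - H₀₀))) a e),
      n2 ((K₁₁⁻¹ * (H₁₁ - H₁₀ - H₀₁ + H₀₀)) a e - (K₁₁⁻¹ * ((K₁₁ - K₀₁) * K₀₁⁻¹ * (H₀₁ - H₀₀))) a e
          - (K₁₁⁻¹ * ((K₁₁ - K₁₀) * K₁₀⁻¹ * (H₁₀ - H₀₀))) a e)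
        ((K₁₁⁻¹ * ((K₁₁ - K₁₀ - K₀₁ + K₀₀) * (K₀₁⁻¹ * H₀₀))) a e),
      n1 ((K₁₁⁻¹ * (H₁₁ - H₁₀ - H₀₁ + H₀₀)) a e - (K₁₁⁻¹ * ((K₁₁ - K₀₁) * K₀₁⁻¹ * (H₀₁ - H₀₀))) a e
          - (K₁₁⁻¹ * ((K₁₁ - K₁₀) * K₁₀⁻¹ * (H₁₀ - H₀₀))) a e
          - (K₁₁⁻¹ * ((K₁₁ - K₁₀ - K₀₁ + K₀₀) * (K₀₁⁻¹ * H₀₀))) a e)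
        ((K₁₁⁻¹ * ((K₁₀ - K₀₀) * K₀₁⁻¹ * (K₀₁ - K₀₀) * (K₀₀⁻¹ * H₀₀))) a e),
      n1 ((K₁₁⁻¹ * (H₁₁ - H₁₀ - H₀₁ + H₀₀)) a e - (K₁₁⁻¹ * ((K₁₁ - K₀₁) * K₀₁⁻¹ * (H₀₁ - H₀₀))) a e
          - (K₁₁⁻¹ * ((K₁₁ - K₁₀) * K₁₀⁻¹ * (H₁₀ - H₀₀))) a e
          - (K₁₁⁻¹ * ((K₁₁ - K₁₀ - K₀₁ + K₀₀) * (K₀₁⁻¹ * H₀₀))) a e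
          + (K₁₁⁻¹ * ((K₁₀ - K₀₀) * K₀₁⁻¹ * (K₀₁ - K₀₀) * (K₀₀⁻¹ * H₀₀))) a e)
        ((K₁₁⁻¹ * ((K₁₁ - K₁₀) * K₁₀⁻¹ * (K₁₀ - K₀₀) * (K₀₀⁻¹ * H₀₀))) a e)]
  have hsum := Finset.sum_le_sum (s := (univ : Finset n)) fun a (_ : a ∈ univ) =>
    Finset.sum_le_sum (s := (univ : Finset n)) fun e (_ : e ∈ univ) => tri a e
  refine hsum.trans ?_
  simp only [Finset.sum_add_distrib]
  have e : α * Sdist * (h₁₂ + α * Sloc * Sdist * (k₁ * h₂ + k₂ * h₁) + α * η * k₁₂ +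
          2 * α ^ 2 * η * Sloc * Sdist * k₁ * k₂) * s * t * Ex =
      α * Sdist * (h₁₂ * s * t * Ex) + α * Sdist * ((k₁ * s) * α * (h₂ * t) * Sloc * Sdist * Ex)
        + α * Sdist * ((k₂ * t) * α * (h₁ * s) * Sloc * Sdist * Ex) + α * Sdist * ((k₁₂ * s * t * Ex) * (α * η))
        + α * Sdist * (((k₁ * s) * α * (k₂ * t) * Sloc * Sdist * Ex) * (α * η))
        + α * Sdist * (((k₂ * t) * α * (k₁ * s) * Sloc * Sdist * Ex) * (α * η)) := by ring
  rw [e]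
  linarith [T1, T2, T3, T4a, T4b, T4c]

/-- ★ **THE HILBERT–SCHMIDT EDITION**: under the same rows, `√(Σ_{a,e} (ΔΔ(K⁻¹H) a e)²)` obeys the same bound (`‖·‖_HS ≤ ‖·‖_{ℓ¹}`).
[cite: Balaban1985Variational, Thm 1 (10) p. 279] [cite: HornJohnson2013, §5.6] -/
theorem sqrt_sum_sum_sq_fourPt_inv_mul_le_of_summedProfiles (dist : n → n → ℕ) (hds : ∀ a b, dist a b = dist b a)
    {K₀₀ K₀₁ K₁₀ K₁₁ H₀₀ H₀₁ H₁₀ H₁₁ : Matrix n n ℝ}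
    (h₀₀ : K₀₀.det ≠ 0) (h₀₁ : K₀₁.det ≠ 0) (h₁₀ : K₁₀.det ≠ 0) (h₁₁ : K₁₁.det ≠ 0)
    {α η k₁ k₂ k₁₂ h₁ h₂ h₁₂ s t θ θ₂ Sloc Sdist : ℝ}
    (hα : 0 ≤ α) (hk₁ : 0 ≤ k₁) (hk₂ : 0 ≤ k₂) (hh₁ : 0 ≤ h₁) (hh₂ : 0 ≤ h₂) (hs : 0 ≤ s) (ht : 0 ≤ t)
    (hθ₂ : 0 ≤ θ₂) (hθ₂θ : θ₂ ≤ θ) (hSdist0 : 0 ≤ Sdist)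
    (hA₀₀ : ∀ a b, |K₀₀⁻¹ a b| ≤ α * Real.exp (-(θ * dist a b)))
    (hA₀₁ : ∀ a b, |K₀₁⁻¹ a b| ≤ α * Real.exp (-(θ * dist a b)))
    (hA₁₀ : ∀ a b, |K₁₀⁻¹ a b| ≤ α * Real.exp (-(θ * dist a b)))
    (hA₁₁ : ∀ a b, |K₁₁⁻¹ a b| ≤ α * Real.exp (-(θ * dist a b)))
    {d d' : n → ℕ} {R : ℕ} (hsep : ∀ a b, R ≤ d a + dist a b + d' b)
    (hSd : ∑ a, Real.exp (-(θ₂ * d a)) ≤ Sloc) (hSd' : ∑ a, Real.exp (-(θ₂ * d' a)) ≤ Sloc)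
    (hSdi : ∀ a, ∑ b, Real.exp (-(θ₂ * dist a b)) ≤ Sdist)
    (hK1c0 : ∀ b, ∑ a, |(K₁₀ - K₀₀) a b| ≤ k₁ * s * Real.exp (-(θ * d b)))
    (hK1c1 : ∀ b, ∑ a, |(K₁₁ - K₀₁) a b| ≤ k₁ * s * Real.exp (-(θ * d b)))
    (hK1r0 : ∀ a, ∑ b, |(K₁₀ - K₀₀) a b| ≤ k₁ * s * Real.exp (-(θ * d a)))
    (hK2c1 : ∀ b, ∑ a, |(K₁₁ - K₁₀) a b| ≤ k₂ * t * Real.exp (-(θ * d' b)))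
    (hK2r0 : ∀ a, ∑ b, |(K₀₁ - K₀₀) a b| ≤ k₂ * t * Real.exp (-(θ * d' a)))
    (hK12 : ∑ a, ∑ b, |(K₁₁ - K₁₀ - K₀₁ + K₀₀) a b| ≤ k₁₂ * s * t * Real.exp (-((θ - θ₂) * R)))
    (hH : ∑ a, ∑ b, |H₀₀ a b| ≤ η)
    (hH1r : ∀ a, ∑ b, |(H₁₀ - H₀₀) a b| ≤ h₁ * s * Real.exp (-(θ * d a)))
    (hH2r : ∀ a, ∑ b, |(H₀₁ - H₀₀) a b| ≤ h₂ * t * Real.exp (-(θ * d' a)))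
    (hH12 : ∑ a, ∑ b, |(H₁₁ - H₁₀ - H₀₁ + H₀₀) a b| ≤ h₁₂ * s * t * Real.exp (-((θ - θ₂) * R))) :
    Real.sqrt (∑ a, ∑ e, ((K₁₁⁻¹ * H₁₁ - K₁₀⁻¹ * H₁₀ - K₀₁⁻¹ * H₀₁ + K₀₀⁻¹ * H₀₀) a e) ^ 2) ≤
      α * Sdist * (h₁₂ + α * Sloc * Sdist * (k₁ * h₂ + k₂ * h₁) + α * η * k₁₂ +
          2 * α ^ 2 * η * Sloc * Sdist * k₁ * k₂) * s * t * Real.exp (-((θ - θ₂) * R)) := by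
  have h := sum_sum_abs_fourPt_inv_mul_le_of_summedProfiles dist hds h₀₀ h₀₁ h₁₀ h₁₁ hα hk₁ hk₂ hh₁ hh₂ hs ht hθ₂ hθ₂θ hSdist0
    hA₀₀ hA₀₁ hA₁₀ hA₁₁ hsep hSd hSd' hSdi hK1c0 hK1c1 hK1r0 hK2c1 hK2r0 hK12 hH hH1r hH2r hH12
  have h0 : 0 ≤ ∑ a, ∑ e, |(K₁₁⁻¹ * H₁₁ - K₁₀⁻¹ * H₁₀ - K₀₁⁻¹ * H₀₁ + K₀₀⁻¹ * H₀₀) a e| :=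
    Finset.sum_nonneg fun a _ => Finset.sum_nonneg fun e _ => abs_nonneg _
  refine (Real.sqrt_le_sqrt (sum_sum_sq_le_sq_sum_sum_abs _)).trans ?_
  rw [Real.sqrt_sq h0]
  exact h

/-! ## §3 The pointwise quadratic form: an entrywise-ℓ¹ letter serves EVERY vector at the price `‖z‖_∞²` -/

omit [DecidableEq n] in
/-- `|zᵀ X z| ≤ ‖z‖_∞²·Σ_{a,e}|X a e|`: an entrywise-ℓ¹ bound on a matrix controls its quadratic form at EVERY vector, with the sup-norm
squared of the vector as the only price (no concentration, no union bound). [cite: HornJohnson2013, §5.6] -/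
theorem abs_dotProduct_mulVec_le_of_sup {X : Matrix n n ℝ} {z : n → ℝ} {ρ : ℝ} (hz : ∀ a, |z a| ≤ ρ) :
    |z ⬝ᵥ (X *ᵥ z)| ≤ ρ ^ 2 * ∑ a, ∑ e, |X a e| := by
  rw [dotProduct]
  refine (Finset.abs_sum_le_sum_abs _ _).trans ?_
  have hpt : ∀ a, |z a * (X *ᵥ z) a| ≤ ∑ e, ρ ^ 2 * |X a e| := by
    intro a
    have hρ0 : 0 ≤ ρ := (abs_nonneg _).trans (hz a)
    rw [abs_mul, Matrix.mulVec, dotProduct]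
    calc |z a| * |∑ e, X a e * z e| ≤ |z a| * ∑ e, |X a e| * |z e| := by
          refine mul_le_mul_of_nonneg_left ((Finset.abs_sum_le_sum_abs _ _).trans (le_of_eq ?_)) (abs_nonneg _)
          exact Finset.sum_congr rfl fun e _ => abs_mul _ _
      _ = ∑ e, |z a| * (|X a e| * |z e|) := by rw [Finset.mul_sum]
      _ ≤ ∑ e, ρ ^ 2 * |X a e| := Finset.sum_le_sum fun e _ => by
          calc |z a| * (|X a e| * |z e|) ≤ ρ * (|X a e| * ρ) :=
                mul_le_mul (hz a) (mul_le_mul_of_nonneg_left (hz e) (abs_nonneg _)) (by positivity) hρ0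
            _ = ρ ^ 2 * |X a e| := by ring
  calc ∑ a, |z a * (X *ᵥ z) a| ≤ ∑ a, ∑ e, ρ ^ 2 * |X a e| := Finset.sum_le_sum fun a _ => hpt a
    _ = ρ ^ 2 * ∑ a, ∑ e, |X a e| := by
        rw [Finset.mul_sum]; exact Finset.sum_congr rfl fun a _ => by rw [Finset.mul_sum]

/-- ★ **THE POINTWISE QUADRATIC FORM OF `ΔΔ(K⁻¹H)`.**  Under the rows of ★★`sum_sum_abs_fourPt_inv_mul_le_of_summedProfiles`, for EVERY vector `z`
with `|z a| ≤ ρ`: `|zᵀ·ΔΔ(K⁻¹H)·z| ≤ ρ²·α·S_dist·(h₁₂ + α·S_loc·S_dist·(k₁h₂ + k₂h₁) + α·η·k₁₂ + 2·α²·η·S_loc·S_dist·k₁k₂)·s·t·e^{−(θ−θ₂)R}` — the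
entrywise-ℓ¹ letter serves all vectors of a sup-ball at once (the consumer's «good set» is then a sup-ball, its tail paid once).
[cite: Balaban1985Variational, Thm 1 (10) p. 279] [cite: HornJohnson2013, §5.6] -/
theorem abs_quadForm_fourPt_inv_mul_le_of_summedProfiles (dist : n → n → ℕ) (hds : ∀ a b, dist a b = dist b a)
    {K₀₀ K₀₁ K₁₀ K₁₁ H₀₀ H₀₁ H₁₀ H₁₁ : Matrix n n ℝ}
    (h₀₀ : K₀₀.det ≠ 0) (h₀₁ : K₀₁.det ≠ 0) (h₁₀ : K₁₀.det ≠ 0) (h₁₁ : K₁₁.det ≠ 0)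
    {α η k₁ k₂ k₁₂ h₁ h₂ h₁₂ s t θ θ₂ Sloc Sdist : ℝ}
    (hα : 0 ≤ α) (hk₁ : 0 ≤ k₁) (hk₂ : 0 ≤ k₂) (hh₁ : 0 ≤ h₁) (hh₂ : 0 ≤ h₂) (hs : 0 ≤ s) (ht : 0 ≤ t)
    (hθ₂ : 0 ≤ θ₂) (hθ₂θ : θ₂ ≤ θ) (hSdist0 : 0 ≤ Sdist)
    (hA₀₀ : ∀ a b, |K₀₀⁻¹ a b| ≤ α * Real.exp (-(θ * dist a b)))
    (hA₀₁ : ∀ a b, |K₀₁⁻¹ a b| ≤ α * Real.exp (-(θ * dist a b)))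
    (hA₁₀ : ∀ a b, |K₁₀⁻¹ a b| ≤ α * Real.exp (-(θ * dist a b)))
    (hA₁₁ : ∀ a b, |K₁₁⁻¹ a b| ≤ α * Real.exp (-(θ * dist a b)))
    {d d' : n → ℕ} {R : ℕ} (hsep : ∀ a b, R ≤ d a + dist a b + d' b)
    (hSd : ∑ a, Real.exp (-(θ₂ * d a)) ≤ Sloc) (hSd' : ∑ a, Real.exp (-(θ₂ * d' a)) ≤ Sloc)
    (hSdi : ∀ a, ∑ b, Real.exp (-(θ₂ * dist a b)) ≤ Sdist)
    (hK1c0 : ∀ b, ∑ a, |(K₁₀ - K₀₀) a b| ≤ k₁ * s * Real.exp (-(θ * d b)))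
    (hK1c1 : ∀ b, ∑ a, |(K₁₁ - K₀₁) a b| ≤ k₁ * s * Real.exp (-(θ * d b)))
    (hK1r0 : ∀ a, ∑ b, |(K₁₀ - K₀₀) a b| ≤ k₁ * s * Real.exp (-(θ * d a)))
    (hK2c1 : ∀ b, ∑ a, |(K₁₁ - K₁₀) a b| ≤ k₂ * t * Real.exp (-(θ * d' b)))
    (hK2r0 : ∀ a, ∑ b, |(K₀₁ - K₀₀) a b| ≤ k₂ * t * Real.exp (-(θ * d' a)))
    (hK12 : ∑ a, ∑ b, |(K₁₁ - K₁₀ - K₀₁ + K₀₀) a b| ≤ k₁₂ * s * t * Real.exp (-((θ - θ₂) * R)))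
    (hH : ∑ a, ∑ b, |H₀₀ a b| ≤ η)
    (hH1r : ∀ a, ∑ b, |(H₁₀ - H₀₀) a b| ≤ h₁ * s * Real.exp (-(θ * d a)))
    (hH2r : ∀ a, ∑ b, |(H₀₁ - H₀₀) a b| ≤ h₂ * t * Real.exp (-(θ * d' a)))
    (hH12 : ∑ a, ∑ b, |(H₁₁ - H₁₀ - H₀₁ + H₀₀) a b| ≤ h₁₂ * s * t * Real.exp (-((θ - θ₂) * R)))
    {z : n → ℝ} {ρ : ℝ} (hz : ∀ a, |z a| ≤ ρ) :
    |z ⬝ᵥ ((K₁₁⁻¹ * H₁₁ - K₁₀⁻¹ * H₁₀ - K₀₁⁻¹ * H₀₁ + K₀₀⁻¹ * H₀₀) *ᵥ z)| ≤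
      ρ ^ 2 * (α * Sdist * (h₁₂ + α * Sloc * Sdist * (k₁ * h₂ + k₂ * h₁) + α * η * k₁₂ +
          2 * α ^ 2 * η * Sloc * Sdist * k₁ * k₂) * s * t * Real.exp (-((θ - θ₂) * R))) :=
  (abs_dotProduct_mulVec_le_of_sup hz).trans (mul_le_mul_of_nonneg_left
    (sum_sum_abs_fourPt_inv_mul_le_of_summedProfiles dist hds h₀₀ h₀₁ h₁₀ h₁₁ hα hk₁ hk₂ hh₁ hh₂ hs ht hθ₂ hθ₂θ hSdist0
      hA₀₀ hA₀₁ hA₁₀ hA₁₁ hsep hSd hSd' hSdi hK1c0 hK1c1 hK1r0 hK2c1 hK2r0 hK12 hH hH1r hH2r hH12) (sq_nonneg ρ))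

end Literature.Analysis.Matrix

end
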